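import Summits.BirchSwinnertonDyer.BirchSwinnertonDyer.Theorems.EisensteinPrimesMazurMCOnCellBKummerCharacterCountStacked
import HarnessLib

/-!
# The STACKED Kummer-character socket over `ℚ`: `GeneratorCountGE W p b` for
# `p^{b+2k} ≤ p^{#T₀+1} · #V` — Tamagawa witnesses on `T₀`, one local kernel class at `p`, and a
# certified group `V` of STRICT Kummer characters counted together
# (route `EisensteinPrimes`, crux 3 `MazurMCOnCellB` = stmt-BirchSwinnertonDyer-19033, line `mudescent`,
# stub 4″ `stub_lambdaCountWeak_offLocus`, ALGEBRAIC half; width seat bsd-line-x2-p1-w3, D-0154 row 5)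

HONEST FRAMING (cell `bsd-eis`; nothing here proves BSD or a main conjecture; 0 cells move): THEOREMS
ONLY — no definition, no named fact, nothing asserted about any particular curve, closes nothing. This
unifies lam-b's socket `EisensteinPrimesX2GeneratorCountAtP.generatorCountGE_of_localKernelClass_torsion`
(`b + 2k ≤ #T₀ + 1`) and this seat's Kummer-character socket (p630234: `p^{b+2k} ≤ #V`) into ONE count,
through the stacking machinery of `…KummerCharacterCountStacked` (p632682): the relaxed Selmer group
`H¹_𝓖` (unramified classes on `T₀`, the local package `𝓛_ξ` at `p`) has
`#H¹_𝓖 = p^{#T₀+1} · #H¹_{𝓖*}`, and the STRICT Kummer-character classes — `[σ ↦ χ(σ)·P̃]` for `χ`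
trivial on the decomposition groups at the places of `T₀ ∪ {p}`, and elsewhere unramified at good places,
trivial, or at a Kummer place — inject into `H¹_{𝓖*}(ℚ, E[p]^D)`.

* `generatorCountGE_of_kummerCharacters_stacked` — hypotheses = those of lam-b's socket (`hPT`, `hfix`,
  `#E[p^∞]^{Γ_ℚ} ≤ p^k`, Tamagawa witnesses `hwit` on `T₀ ∌ p`, one local kernel class `hξ` at `v_p`)
  + those of the Kummer-character socket (`P̃`, `hΨ`, `V` with `hV0`: trivial on `Γ_{ℚ_v}` for
  `v ∈ T₀ ∪ {v_p}`, `hV`: at `v ∉ T₀ ∪ {v_p}` (good ∧ unramified) ∨ trivial ∨ Kummer place). Conclusion: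
  **`GeneratorCountGE W p b` whenever `p^{b+2k} ≤ p^{#T₀+1} · #V`.**
* `X2.generatorCountGE_of_kummerCharacters_stacked_of_dvd_torsionOrder`,
  `X2.algebraicLambdaGE_of_kummerCharacters_stacked_of_dvd_torsionOrder` — at an odd multiplicative `p`
  with `p ∣ #E(ℚ)_tors`: `P̃`, `hΨ` (Weil pairing, p630799), `hfix`, `k = v_p(#E(ℚ)_tors)`, the split local
  kernel class (lam-b p479686; `p ∣ #tors` forces `p` split) all DISCHARGED; Tamagawa witnesses from
  `p ∣ c_v` (Kodaira–Néron, tree); so the inputs are `hPT` + the integer data `S` (`p ∣ c_v`), `V`, `m`: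
  **`AlgebraicLambdaGE W p (b − m)` for `p^{b + 2·v_p(#E(ℚ)_tors)} ≤ p^{#S+1} · #V`** — at the étale end
  (`m = 0`, `v_p(#tors) = 1`, `#V = p^d`): `λ(X(E/ℚ_∞)) ≥ #S + d − 1`, the Tamagawa budget AND the Kummer
  budget at once.

References: [GreenbergLNM1716] §3 pp. 85–93, §5 pp. 114–118, p. 137; [MilneADT2006] I Thm. 2.8, 4.10;
[GreenbergVatsal2000] §2; [Wuthrich2014] Thm. 16.
-/

set_option autoImplicit false
-- `Summit.BirchSwinnertonDyer.BirchSwinnertonDyer.…`: the summit and its single sub-problem share a name (D-0017 layout).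
set_option linter.dupNamespace false

noncomputable section

open scoped Classical

open Function Field NumberField IsDedekindDomain WeierstrassCurve
  Literature.NumberTheory.EllipticCurves Literature.NumberTheory.GaloisRepresentations
  Literature.NumberTheory.GaloisCohomology
  Literature.NumberTheory.EllipticCurves.Rank1Residual Literature.NumberTheory.EllipticCurves.ModularForms
  Summit.BirchSwinnertonDyer.Rank1Residual
  Summit.BirchSwinnertonDyer.Rank1Residual.GaloisImage
  Summit.BirchSwinnertonDyer.Rank1Residual.X1.GeneratorCountSqueeze
  Summit.BirchSwinnertonDyer.Rank1Residual.X1.TamagawaSqueeze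
  Summit.BirchSwinnertonDyer.BirchSwinnertonDyer.Theorems.EisensteinPrimesAlgebraicLambdaGEBudget
  Summit.BirchSwinnertonDyer.BirchSwinnertonDyer.Theorems.EisensteinPrimesX2GeneratorCountAtP
  Summit.BirchSwinnertonDyer.BirchSwinnertonDyer.Theorems.EisensteinPrimesX2SplitTorsionLocalKernelClass
  Summit.BirchSwinnertonDyer.BirchSwinnertonDyer.Theorems.EisensteinPrimesX2AlgebraicLambdaGESplitTorsion
  Summit.BirchSwinnertonDyer.BirchSwinnertonDyer.Theorems.EisensteinPrimesMazurMCOnCellBKummerCharacterCocycles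
  Summit.BirchSwinnertonDyer.BirchSwinnertonDyer.Theorems.EisensteinPrimesMazurMCOnCellBKummerPlaceClasses
  Summit.BirchSwinnertonDyer.BirchSwinnertonDyer.Theorems.EisensteinPrimesMazurMCOnCellBKummerCharacterCountOfTorsion
  Summit.BirchSwinnertonDyer.BirchSwinnertonDyer.Theorems.EisensteinPrimesMazurMCOnCellBKummerCharacterCountStacked
open Literature.NumberTheory.GaloisRepresentations.DiscreteGaloisModule (SelmerStructure unramifiedSubgroup)

namespace Summit.BirchSwinnertonDyer.BirchSwinnertonDyer.Theorems.EisensteinPrimesMazurMCOnCellBKummerCharacterCountStackedRat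

variable {W : WeierstrassCurve ℚ} [W.IsElliptic] [W.IsGloballyMinimal] {p : ℕ} [hp : Fact p.Prime]

/-! ## §1. Over `ℚ`: `GeneratorCountGE W p b` for `p^{b+2k} ≤ p^{#T₀+1} · #V` -/

/-- **The stacked count over `ℚ`.** `W/ℚ` globally minimal, `p` odd; Poitou–Tate duality over `ℚ`
(`hPT`); `E(ℚ_∞)[p^∞]` finite (`hfix`); `#E[p^∞]^{Γ_ℚ} ≤ p^k`; `P̃ ∈ E[p]` non-zero fixed with `hΨ`;
Tamagawa witnesses on `T₀` (`v ∤ p`); a place `v_p ∋ p` with one local kernel class `ξ` (`hξ`); and a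
finite group `V` of continuous characters `Γ_ℚ →ₜ* ℤ/p`, each TRIVIAL on `Γ_{ℚ_v}` for `v ∈ T₀ ∪ {v_p}`
(`hV0`) and, at every other `v`, unramified at a good place, or trivial, or at a Kummer place (`hV`).
Then `GeneratorCountGE W p b` for every `b` with `p^{b+2k} ≤ p^{#T₀+1} · #V`: the relaxed Selmer group
of `…CountStacked.exists_addSubgroup_relaxedKummer_at_of_strict` fed with the strict classes
`θ(V)` (injective by p629806; Kummer off `T₀ ∪ {v_p}` by p629822 and the tree; `0` on `T₀ ∪ {v_p}`),
then eisenstein-p1's lossy count exactly as in lam-b's `generatorCountGE_of_localKernelClass_torsion`.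
[cite: GreenbergLNM1716, §3 Lemma 3.1, pp. 91–93, §5 pp. 114–118, p. 137] [cite: MilneADT2006, Ch. I Thm. 4.10] -/
theorem generatorCountGE_of_kummerCharacters_stacked (hodd : p ≠ 2)
    (hPT : poitouTate_selmerStructure_duality ℚ)
    (hfix : ∀ κ : ZpExtension ℚ p, κ.IsCyclotomic →
      Finite (FixedPoints.addSubgroup κ.kerSubgroup (W.geomPrimaryTorsion p)))
    {k : ℕ}
    (hB : Nat.card {a : geomPrimaryTorsion W p // ∀ σ : absoluteGaloisGroup ℚ, σ • a = a} ≤ p ^ k)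
    (Pt : geomTorsion W (p : ℤ)) (hPt : ∀ σ : absoluteGaloisGroup ℚ, σ • Pt = Pt) (hPt0 : Pt ≠ 0)
    (hΨ : ∀ Q : geomTorsion W (p : ℤ),
      (∀ σ : absoluteGaloisGroup ℚ, σ • Q - Q ∈ AddSubgroup.zmultiples Pt) →
        Q ∈ AddSubgroup.zmultiples Pt)
    (T₀ : Finset (HeightOneSpectrum (𝓞 ℚ))) (hT₀p : ∀ v ∈ T₀, ((p : ℕ) : 𝓞 ℚ) ∉ v.asIdeal)
    (hwit : ∀ v ∈ T₀, ∃ u ∈ unramifiedSubgroup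
        ((W.torsionGaloisModule (p : ℤ)).restrictField (v.adicCompletion ℚ)) 1,
      u ∉ W.kummerLocalConditionAt (p : ℤ) (v.adicCompletion ℚ))
    (vp : HeightOneSpectrum (𝓞 ℚ)) (hvp : ((p : ℕ) : 𝓞 ℚ) ∈ vp.asIdeal)
    (hξ : ∀ κ : ZpExtension ℚ p, κ.IsCyclotomic →
      ∃ ξ : galoisCohomology (W.localGaloisModule (vp.adicCompletion ℚ)) 1, ξ ≠ 0 ∧ p • ξ = 0 ∧
        ξ ∈ (galoisCohomology.map (W.torsionPointsMapIntertwining (p : ℤ) (vp.adicCompletion ℚ)) 1).range ∧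
        resH1Hom (Literature.NumberTheory.EllipticCurves.subgroupIncl
            (localSubgroup κ.kerSubgroup (vp.adicCompletion ℚ)))
          (AddMonoidHom.id (localPoints W (vp.adicCompletion ℚ))) (fun _ _ ↦ rfl) ξ = 0)
    (V : Subgroup (absoluteGaloisGroup ℚ →ₜ* Multiplicative (ZMod p))) [Finite V]
    (hV0 : ∀ χ ∈ V, ∀ v ∈ insert vp T₀, ∀ σ : absoluteGaloisGroup (v.adicCompletion ℚ),
      χ (resGal (K := ℚ) (v.adicCompletion ℚ) σ) = 1)
    (hV : ∀ χ ∈ V, ∀ v ∉ insert vp T₀,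
      (W.HasGoodReductionAt v ∧
        ∀ τ ∈ absInertia (v.adicCompletion ℚ), χ (resGal (K := ℚ) (v.adicCompletion ℚ) τ) = 1) ∨
      (∀ σ : absoluteGaloisGroup (v.adicCompletion ℚ), χ (resGal (K := ℚ) (v.adicCompletion ℚ) σ) = 1) ∨
      (W.HasSplitMultiplicativeReductionAt v ∧ ∀ x : v.adicCompletion ℚ,
        Valued.v (algebraMap ℚ (v.adicCompletion ℚ) W.j) ≠ Valued.v x ^ p))
    {b : ℕ} (hb : p ^ (b + 2 * k) ≤ p ^ (T₀.card + 1) * Nat.card V) : GeneratorCountGE W p b := by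
  haveI : NeZero p := ⟨hp.out.ne_zero⟩
  obtain ⟨inv, hperf, hsum, -, hcompl⟩ := hPT p
  have hvpT₀ : vp ∉ T₀ := fun h ↦ hT₀p vp h hvp
  intro κ γ hκ _ _ D _ _
  haveI := hfix κ hκ
  obtain ⟨ξ, hξ0, hξp, hξr, hξK⟩ := hξ κ hκ
  obtain ⟨h𝓛, hcard⟩ := kummer_le_comap_zmultiples_and_natCard vp ξ hξ0 hξp hξr
  let 𝓛 : ∀ v : HeightOneSpectrum (𝓞 ℚ),
      AddSubgroup (galoisCohomology ((W.torsionGaloisModule (p : ℤ)).toLocal (Sum.inr v)) 1) :=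
    Function.update (fun _ ↦ ⊤) vp
      ((AddSubgroup.zmultiples ξ).comap
        (galoisCohomology.map (W.torsionPointsMapIntertwining (p : ℤ) (vp.adicCompletion ℚ)) 1))
  have h𝓛vp : 𝓛 vp = (AddSubgroup.zmultiples ξ).comap
      (galoisCohomology.map (W.torsionPointsMapIntertwining (p : ℤ) (vp.adicCompletion ℚ)) 1) :=
    Function.update_self _ _ _
  -- the strict Kummer-character classes
  choose φ hφ using fun χ : absoluteGaloisGroup ℚ →ₜ* Multiplicative (ZMod p) ↦
    exists_cocycle_of_character W χ Pt hPt
  have hpPt : p • Pt = 0 := Subtype.ext (by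
    rw [AddSubgroupClass.coe_nsmul, ZeroMemClass.coe_zero]
    exact AddSubgroup.torsionBy.nsmul_iff.mp Pt.2)
  have hφ_mul : ∀ χ₁ χ₂ : absoluteGaloisGroup ℚ →ₜ* Multiplicative (ZMod p),
      φ (χ₁ * χ₂) = φ χ₁ + φ χ₂ := fun χ₁ χ₂ ↦ by
    apply Subtype.ext
    refine ContinuousMap.ext fun σ ↦ ?_
    rw [Submodule.coe_add, ContinuousMap.add_apply, hφ, hφ, hφ, ContinuousMonoidHom.mul_apply, toAdd_mul,
      ZMod.val_add, ← nsmul_eq_mod_nsmul _ hpPt, add_nsmul]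
  have hφ_one : φ 1 = 0 := by
    apply Subtype.ext
    refine ContinuousMap.ext fun σ ↦ ?_
    rw [Submodule.coe_zero, ContinuousMap.zero_apply, hφ, ContinuousMonoidHom.coe_one, Pi.one_apply, toAdd_one,
      ZMod.val_zero, zero_smul]
  let θ : (absoluteGaloisGroup ℚ →ₜ* Multiplicative (ZMod p)) →* Multiplicative (galH1Torsion W (p : ℤ)) :=
    { toFun := fun χ ↦ Multiplicative.ofAdd
        (oneCocycleClass (discreteTopRep (absoluteGaloisGroup ℚ) (geomTorsion W (p : ℤ))) (φ χ))
      map_one' := by rw [hφ_one, oneCocycleClass_zero]; rfl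
      map_mul' := fun χ₁ χ₂ ↦ by rw [hφ_mul, oneCocycleClass_add]; rfl }
  have hθinj : Function.Injective θ := by
    rw [← MonoidHom.ker_eq_bot_iff, Subgroup.eq_bot_iff_forall]
    intro χ hχ
    exact character_eq_one_of_oneCocycleClass_eq_zero W χ Pt hPt hPt0 hΨ (φ χ) (hφ χ)
      (toAdd_eq_zero.mpr ((MonoidHom.mem_ker).mp hχ))
  let ycl : V → galoisCohomology (W.torsionGaloisModule (p : ℤ)) 1 := fun χ ↦
    oneCocycleClass (discreteTopRep (absoluteGaloisGroup ℚ) (geomTorsion W (p : ℤ))) (φ χ)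
  have hinj : Function.Injective ycl := fun χ χ' h ↦
    Subtype.ext (hθinj (congrArg Multiplicative.ofAdd h))
  have hφloc : ∀ (χ : absoluteGaloisGroup ℚ →ₜ* Multiplicative (ZMod p)) (v : HeightOneSpectrum (𝓞 ℚ))
      (σ : absoluteGaloisGroup (v.adicCompletion ℚ)),
      (φ χ).1 (resGal (K := ℚ) (v.adicCompletion ℚ) σ) =
        (Multiplicative.toAdd ((χ.comp (resGal (K := ℚ) (v.adicCompletion ℚ))) σ)).val • Pt :=
    fun χ v σ ↦ hφ χ _
  have hyK : ∀ χ : V, ∀ v ∉ insert vp T₀, galoisCohomology.localization (W.torsionGaloisModule (p : ℤ))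
      (Sum.inr v) 1 (ycl χ) ∈ W.kummerSelmerStructure (p : ℤ) (Sum.inr v) := by
    intro χ v hv
    change galoisCohomology.res (W.torsionGaloisModule (p : ℤ)) (v.adicCompletion ℚ) 1 (ycl χ) ∈
      W.kummerLocalConditionAt (p : ℤ) (v.adicCompletion ℚ)
    rcases hV χ χ.2 v hv with ⟨hgood, hur⟩ | htriv | ⟨hsplit, hj⟩
    · exact X10.SelfTwist.unramifiedSubgroup_le_kummerLocalConditionAt_of_hasGoodReductionAt W hgood
        (p : ℤ) (res_oneCocycleClass_mem_unramifiedSubgroup_of_inertia W v Pt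
          ((χ : absoluteGaloisGroup ℚ →ₜ* Multiplicative (ZMod p)).comp (resGal (K := ℚ) (v.adicCompletion ℚ)))
          hur (φ _) (hφloc _ v))
    · rw [res_oneCocycleClass_eq_zero_of_trivial W v Pt
        ((χ : absoluteGaloisGroup ℚ →ₜ* Multiplicative (ZMod p)).comp (resGal (K := ℚ) (v.adicCompletion ℚ)))
        htriv (φ _) (hφloc _ v)]
      exact zero_mem _
    · exact res_oneCocycleClass_mem_kummerLocalConditionAt_of_split W v hsplit hj Pt hPt
        ((χ : absoluteGaloisGroup ℚ →ₜ* Multiplicative (ZMod p)).comp (resGal (K := ℚ) (v.adicCompletion ℚ)))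
        (φ _) (hφloc _ v)
  have hy0 : ∀ χ : V, ∀ v ∈ insert vp T₀, galoisCohomology.localization (W.torsionGaloisModule (p : ℤ))
      (Sum.inr v) 1 (ycl χ) = 0 := by
    intro χ v hv
    exact res_oneCocycleClass_eq_zero_of_trivial W v Pt
      ((χ : absoluteGaloisGroup ℚ →ₜ* Multiplicative (ZMod p)).comp (resGal (K := ℚ) (v.adicCompletion ℚ)))
      (hV0 χ χ.2 v hv) (φ _) (hφloc _ v)
  -- the relaxed subgroup, the strict classes counted
  obtain ⟨Sg, hSfin, hScard, hS⟩ := exists_addSubgroup_relaxedKummer_at_of_strict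
    (W := W) hodd inv hperf hsum hcompl (EP.forall_localEulerPoincareCharacteristic_adicCompletion ℚ)
    T₀ hwit vp hvpT₀ 𝓛 (by rw [h𝓛vp]; exact h𝓛) (by rw [h𝓛vp]; exact hcard.le) ycl hinj hyK hy0
  haveI := hSfin
  have hcount := X1.GeneratorCountTorsion.natCard_le_natCard_quotient_maximalIdeal_mul_sq W κ D Sg
    (↑(insert vp T₀) : Set (HeightOneSpectrum (𝓞 ℚ))) (fun y hy v hv ↦ (hS y hy).1 v hv)
    (fun y hy w ↦ (hS y hy).2.1 w) fun y hy v hv ↦ by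
      rcases Finset.mem_insert.mp (Finset.mem_coe.mp hv) with rfl | hv
      · have hy' := (hS y hy).2.2.2
        rw [h𝓛vp] at hy'
        have hy'' : galoisCohomology.map (W.torsionPointsMapIntertwining (p : ℤ) (v.adicCompletion ℚ)) 1
            (galoisCohomology.res (W.torsionGaloisModule (p : ℤ)) (v.adicCompletion ℚ) 1 y) ∈
            AddSubgroup.zmultiples ξ := hy'
        exact layerToInfty_resH1Hom_torsionToPrimaryH1_mem_localKerOver_of_map_res_mem_zmultiples W p
          κ v ξ hξK y hy''
      · exact Additive.layerToInfty_resH1Hom_torsionToPrimaryH1_mem_localKerOver_of_mem_unramified_sup_kummer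
          W p κ v (hT₀p v hv) (Additive.exists_apply_resGal_ne_one_of_isCyclotomic κ hκ v (hT₀p v hv)) y
          ((hS y hy).2.2.1 v hv)
  have hV' : Nat.card V = Nat.card (↥V) := rfl
  have h1 : p ^ b * p ^ (2 * k) ≤ Nat.card (D.X ⧸ IsLocalRing.maximalIdeal (IwasawaAlgebra p) •
      (⊤ : Submodule (IwasawaAlgebra p) D.X)) * p ^ (2 * k) :=
    calc p ^ b * p ^ (2 * k) = p ^ (b + 2 * k) := (pow_add p b (2 * k)).symm
      _ ≤ p ^ (T₀.card + 1) * Nat.card V := hb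
      _ ≤ Nat.card Sg := hScard
      _ ≤ _ := hcount
      _ ≤ Nat.card (D.X ⧸ IsLocalRing.maximalIdeal (IwasawaAlgebra p) •
            (⊤ : Submodule (IwasawaAlgebra p) D.X)) * (p ^ k) ^ 2 :=
          Nat.mul_le_mul_left _ (Nat.pow_le_pow_left hB 2)
      _ = _ := by rw [← pow_mul, mul_comm k 2]
  exact Nat.le_of_mul_le_mul_right h1 (pow_pos hp.out.pos _)

/-! ## §2. X2 at `p ∣ #E(ℚ)_tors`: every input but `hPT`, the integer data and `V` discharged -/

/-- **X2 stacked count.** `W/ℚ` globally minimal, `p` odd MULTIPLICATIVE with `p ∣ #E(ℚ)_tors` (so `p`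
is split and `E` carries a rational point of order `p`), `S` a finite set of places `v ∤ p` with
`p ∣ c_v(E)` (Tamagawa rows), and `V` a finite group of continuous characters `Γ_ℚ →ₜ* ℤ/p`, each trivial
on `Γ_{ℚ_v}` for `v ∈ S` and for `v ∣ p` (`hV0`) and, at every other `v`, unramified at a good place, or
trivial, or at a Kummer place (`hV`). Then `GeneratorCountGE W p b` whenever
`p^{b + 2·v_p(#E(ℚ)_tors)} ≤ p^{#S+1} · #V` — §1 with `P̃` from the torsion, `hΨ` by the Weil pairing
(p630799), the split local kernel class at `p` (lam-b p479686), the Tamagawa witnesses (Kodaira–Néron,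
tree), `E(ℚ_∞)[p^∞]` finite and `#E[p^∞]^{Γ_ℚ} ≤ p^{v_p(#E(ℚ)_tors)}` (tree). Named fact: `hPT`.
[cite: GreenbergLNM1716, §3 pp. 91–93, §5 pp. 114–118, p. 137] [cite: SilvermanAEC2009, §VIII.7] -/
theorem X2.generatorCountGE_of_kummerCharacters_stacked_of_dvd_torsionOrder (hodd : p ≠ 2)
    (hPT : poitouTate_selmerStructure_duality ℚ) (hmult : W.HasMultiplicativeReductionAtPrime p)
    (htors : p ∣ W.torsionOrder) (S : Finset (HeightOneSpectrum (𝓞 ℚ)))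
    (hSp : ∀ v ∈ S, ((p : ℕ) : 𝓞 ℚ) ∉ v.asIdeal)
    (hcv : ∀ v ∈ S,
      p ∣ (W.baseChange (v.adicCompletion ℚ)).localTamagawaNumber (v.adicCompletionIntegers ℚ))
    (V : Subgroup (absoluteGaloisGroup ℚ →ₜ* Multiplicative (ZMod p))) [Finite V]
    (hV0 : ∀ χ ∈ V, ∀ v : HeightOneSpectrum (𝓞 ℚ), (v ∈ S ∨ ((p : ℕ) : 𝓞 ℚ) ∈ v.asIdeal) →
      ∀ σ : absoluteGaloisGroup (v.adicCompletion ℚ), χ (resGal (K := ℚ) (v.adicCompletion ℚ) σ) = 1)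
    (hV : ∀ χ ∈ V, ∀ v ∉ S, ((p : ℕ) : 𝓞 ℚ) ∉ v.asIdeal →
      (W.HasGoodReductionAt v ∧
        ∀ τ ∈ absInertia (v.adicCompletion ℚ), χ (resGal (K := ℚ) (v.adicCompletion ℚ) τ) = 1) ∨
      (∀ σ : absoluteGaloisGroup (v.adicCompletion ℚ), χ (resGal (K := ℚ) (v.adicCompletion ℚ) σ) = 1) ∨
      (W.HasSplitMultiplicativeReductionAt v ∧ ∀ x : v.adicCompletion ℚ,
        Valued.v (algebraMap ℚ (v.adicCompletion ℚ) W.j) ≠ Valued.v x ^ p))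
    {b : ℕ} (hb : p ^ (b + 2 * (W.torsionOrder).factorization p) ≤ p ^ (S.card + 1) * Nat.card V) :
    GeneratorCountGE W p b := by
  have hp3 : 3 ≤ p := by
    have h2 := hp.out.two_le
    omega
  have hsplit : W.HasSplitMultiplicativeReductionAtPrime p :=
    X2.hasSplitMultiplicativeReductionAtPrime_of_dvd_torsionOrder W p hp3 hmult htors
  -- the place above `p`
  set vp : HeightOneSpectrum (𝓞 ℚ) := (Rat.HeightOneSpectrum.primesEquiv (R := 𝓞 ℚ)).symm ⟨p, hp.out⟩
    with hvpdef
  have hvp : ((p : ℕ) : 𝓞 ℚ) ∈ vp.asIdeal :=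
    (natCast_mem_asIdeal_iff_eq_primesEquiv_symm vp hp.out).mpr hvpdef
  -- the rational `p`-torsion, seen in `E[p]`
  obtain ⟨Pt, hPt0, hPt⟩ := exists_fixed_geomTorsion_of_dvd_torsionOrder W p htors
  refine generatorCountGE_of_kummerCharacters_stacked hodd hPT
    (fun κ hκ ↦ X2.GreenbergVatsalTransferMultiplicative.finite_fixedPoints_kerSubgroup_of_hasMultiplicativeReductionAtPrime
      W p TateCurve.Silverman1994_thmV53_corV54_tateUniformisation_holds hodd hmult κ hκ)
    (X1.GeneratorCountTorsion.natCard_fixedPoints_le_pow_factorization_torsionOrder W p) Pt hPt hPt0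
    (fun Q hQ ↦ mem_zmultiples_of_forall_smul_sub_mem W (eq_one_of_pow_eq_one_rat hodd) Pt hPt hPt0 Q hQ)
    S hSp (fun v hv ↦ ?_) vp hvp
    (fun κ hκ ↦ X2.exists_localKernelClass_of_split_of_fixed_torsion hodd hsplit Pt hPt hPt0 vp hvp κ hκ)
    V (fun χ hχ v hv σ ↦ ?_) (fun χ hχ v hv ↦ ?_) hb
  · -- Tamagawa witnesses at `v ∈ S` (Kodaira–Néron; tree theorems)
    haveI : Finite (IsLocalRing.ResidueField (v.adicCompletionIntegers ℚ)) :=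
      HeightOneSpectrum.finite_residueField_adicCompletionIntegers ℚ v
    rcases Additive.hasAdditiveReductionAt_or_hasSplitMultiplicativeReductionAt_of_dvd_localTamagawaNumber
        W v hodd (hcv v hv) with hadd | hspl
    · exact Additive.exists_mem_unramifiedSubgroup_not_mem_kummerLocalConditionAt_of_hasAdditiveReductionAt
        W p v (hSp v hv) hodd hadd (hcv v hv)
    · exact Additive.exists_mem_unramifiedSubgroup_not_mem_kummerLocalConditionAt_of_split_of_dvd_localTamagawaNumber
        W v hspl (hSp v hv) (hcv v hv)
  · -- `χ` is trivial on `Γ_{ℚ_v}` for `v ∈ S ∪ {v_p}`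
    rcases Finset.mem_insert.mp hv with rfl | hv
    · exact hV0 χ hχ _ (Or.inr hvp) σ
    · exact hV0 χ hχ v (Or.inl hv) σ
  · -- off `S ∪ {v_p}`: `v ∤ p`
    have hvS : v ∉ S := fun h ↦ hv (Finset.mem_insert_of_mem h)
    have hvp' : ((p : ℕ) : 𝓞 ℚ) ∉ v.asIdeal := fun h ↦ hv (by
      rw [(natCast_mem_asIdeal_iff_eq_primesEquiv_symm v hp.out).mp h]
      exact Finset.mem_insert_self _ _)
    exact hV χ hχ v hvS hvp'

/-- **X2, the stacked λ-bound: `AlgebraicLambdaGE W p (b − m)` for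
`p^{b + 2·v_p(#E(ℚ)_tors)} ≤ p^{#S+1} · #V` at a member with `μ_an ≤ m`** (`p ‖ N` odd, `p ∣ #E(ℚ)_tors`;
named facts `hPT`, `h415`, `hWu`, `hpar` exactly as in lam-b's
`X2.algebraicLambdaGE_of_dvd_torsionOrder_of_dvd_localTamagawaNumber`). At the étale end of a type-A class
(`m = 0`, `v_p(#E(ℚ)_tors) = 1`) with `#V = p^d`: `λ(X(E/ℚ_∞)) ≥ #S + d − 1` — the layer-`0` Tamagawa
budget (`#S + 1`, lam-b) and the Kummer-character budget (`d`, this seat) TOGETHER, minus the torsion loss.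
[cite: GreenbergLNM1716, §5 pp. 114–118, p. 137, Prop. 4.15 (ii)] [cite: Wuthrich2014, Thm. 16 (p. 397)] -/
theorem X2.algebraicLambdaGE_of_kummerCharacters_stacked_of_dvd_torsionOrder (hodd : p ≠ 2)
    (hPT : poitouTate_selmerStructure_duality ℚ)
    (h415 : Greenberg1999.prop415ii_noFiniteSubmodule_of_ordinary_or_multiplicative)
    (hWu : Wuthrich2014.thm16_charIdeal_dvd_multiplicative_of_reducible)
    (hpar : nonempty_modularParametrizationData)
    (hmult : W.HasMultiplicativeReductionAtPrime p) (htors : p ∣ W.torsionOrder)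
    (S : Finset (HeightOneSpectrum (𝓞 ℚ))) (hSp : ∀ v ∈ S, ((p : ℕ) : 𝓞 ℚ) ∉ v.asIdeal)
    (hcv : ∀ v ∈ S,
      p ∣ (W.baseChange (v.adicCompletion ℚ)).localTamagawaNumber (v.adicCompletionIntegers ℚ))
    (V : Subgroup (absoluteGaloisGroup ℚ →ₜ* Multiplicative (ZMod p))) [Finite V]
    (hV0 : ∀ χ ∈ V, ∀ v : HeightOneSpectrum (𝓞 ℚ), (v ∈ S ∨ ((p : ℕ) : 𝓞 ℚ) ∈ v.asIdeal) →
      ∀ σ : absoluteGaloisGroup (v.adicCompletion ℚ), χ (resGal (K := ℚ) (v.adicCompletion ℚ) σ) = 1)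
    (hV : ∀ χ ∈ V, ∀ v ∉ S, ((p : ℕ) : 𝓞 ℚ) ∉ v.asIdeal →
      (W.HasGoodReductionAt v ∧
        ∀ τ ∈ absInertia (v.adicCompletion ℚ), χ (resGal (K := ℚ) (v.adicCompletion ℚ) τ) = 1) ∨
      (∀ σ : absoluteGaloisGroup (v.adicCompletion ℚ), χ (resGal (K := ℚ) (v.adicCompletion ℚ) σ) = 1) ∨
      (W.HasSplitMultiplicativeReductionAt v ∧ ∀ x : v.adicCompletion ℚ,
        Valued.v (algebraMap ℚ (v.adicCompletion ℚ) W.j) ≠ Valued.v x ^ p))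
    {m : ℕ} (hμ : X2.AnalyticMuLE W p m)
    {b : ℕ} (hb : p ^ (b + 2 * (W.torsionOrder).factorization p) ≤ p ^ (S.card + 1) * Nat.card V) :
    AlgebraicLambdaGE W p (b - m) :=
  X2.algebraicLambdaGE_of_generatorCountGE_of_analyticMuLE hWu hpar h415 hodd hmult
    (not_hasIrreducibleModPGaloisRep_of_dvd_torsionOrder W p htors) hμ
    (X2.generatorCountGE_of_kummerCharacters_stacked_of_dvd_torsionOrder hodd hPT hmult htors S hSp hcv V hV0
      hV hb)

end Summit.BirchSwinnertonDyer.BirchSwinnertonDyer.Theorems.EisensteinPrimesMazurMCOnCellBKummerCharacterCountStackedRat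

end
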